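import Literature.Analysis.FluidPDE.LocalTypeIReverseTools
import Literature.Analysis.FluidPDE.LocalTypeIWeakSerrinProofs
import Literature.Analysis.FluidPDE.SingularSetRescaling
import HarnessLib

/-!
# Albritton–Barker's Type I quantity under the viscosity-normalising (anisotropic) rescaling

Analysis/FluidPDE proofs-layer file (theorems only; no definitions, no named facts) over
`LocalTypeI.lean` / `LocalTypeIScaling.lean` (Albritton–Barker 2019, §1: the scaled quantities
`A, C, D, E` and `𝐈(ω) = sup_{Q' ⊂ ω} (A + C + D + E)(Q')`).

`LocalTypeIScaling.lean` proves that `A, C, D, E` and `𝐈` are INVARIANT under the parabolic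
(Navier–Stokes) rescaling `v = c u ∘ Φ`, `Φ(s, y) = (t₀ + c² s, x₀ + c y)`. The rescaling which
in addition normalises a viscosity `ν ≠ 1` to `1` — `v = α u ∘ Φ`, `π = α² q ∘ Φ`,
`∇v = (α γ) (∇u) ∘ Φ` with `Φ(s, y) = (t₀ + β s, x₀ + γ y)` and `β = γ²/ν`, `α = γ/ν`
(the scaling symmetry of Koch–Nadirashvili–Seregin–Šverák 2009, §1, combined with the reduction
to unit viscosity of Caffarelli–Kohn–Nirenberg 1982, §1; the zoom used by the tree's
`SereginSverak2002.exists_zoom_typeIBound_lt_top` and by the Summits-side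
`exists_zoom_typeIBound_lt_top_of_localTypeI`) — is ANISOTROPIC when `β ≠ γ²`: it maps the
parabolic balls `Q(z, r) = (t − r², t) × B(x, r)` of the `u`-frame onto cylinders of the
`v`-frame with radius `r/γ` but time-length `r²/β`, which are not parabolic balls. The four
quantities are then no longer invariant, but they are COMPARABLE up to constants once the
`v`-side ball is enlarged so as to contain the image cylinder: with
`M = γ⁻¹ + (√β)⁻¹`, `r' = M r` and `z' = Φ⁻¹ z`, one has `Φ⁻¹(Q(z, r)) ⊆ Q(z', r')`, and

* `cknAEss_le_mul_cknAEss_stRescale`, `cknC_le_mul_cknC_stRescale`,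
  `cknE_le_mul_cknE_stRescale`, `cknDOsc_le_mul_cknDOsc_stRescale`:
  `X(Q(z, r); u, q, ∇u) ≤ K_X(α, β, γ) · X(Q(z', r'); v, π, ∇v)` for `X = A, C, E, D` (for `D`,
  whose ball mean is taken over the enlarged ball on the right, the comparison goes through the
  tree's `cknDOsc_sub_fun_time` — `D` does not see functions of time, so the `u`-side pressure
  may be the UN-gauged one — and `cknDOsc_le_four_mul_cknD`);
* `abScaledSum_le_mul_abScaledSum_stRescale`: the same for `A + C + D + E`, with an
  `r`-independent constant;
* `typeIBound_apex_le_mul_typeIBound_stRescale`: consequently, for the apex region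
  `ω = Q((t₀, x₀), r₀)` of the `u`-frame and the ball `Q(0, ρ)` of the `v`-frame,
  `𝐈(Q((t₀,x₀), r₀); u, q, ∇u) ≤ K · 𝐈(Q(0, ρ); v, π, ∇v)` as soon as
  `r₀ (γ⁻¹ + 2(√β)⁻¹) ≤ ρ`;
* `exists_typeIBound_apex_lt_top_of_stRescale`: in particular, if the zoomed triple has
  `𝐈(Q(0, ρ)) < ∞` for some `ρ > 0`, then `𝐈(Q((t₀, x₀), r₀); u, q, ∇u) < ∞` for some `r₀ > 0` —
  the UN-ZOOM step that turns the tree's zoomed local Type I bound at a Type I blow-up point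
  (Albritton–Barker 2019, Lemma 2.5 with Remark 3.2, tree
  `albrittonBarker2019_lemma_2_5_rate_holds`, fed by the viscosity-normalising zoom) into a
  local Type I bound in the ORIGINAL frame of a classical solution with viscosity `ν` (the form
  asked by the registered stub `stub_localTypeI_of_typeIBlowup` of the line `extinct-apex` on
  item stmt-NavierStokesRegularity-18385).

All constants are explicit finite products of `ENNReal.ofReal` of positive reals; only their
finiteness is used downstream. Everything is folklore scaling bookkeeping; the equations are not
used. Companion of `SingularSetRescaling.lean`, which transports regular points, singular sets and
`𝒫^s`-null sets along the same two-parameter family of maps (and whose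
`inv_smul_stPull_symm_smul_stPull` is reused here).

## References

* D. Albritton, T. Barker, *On local Type I singularities of the Navier–Stokes equations and
  Liouville theorems*, J. Math. Fluid Mech. 21 (2019) = arXiv:1811.00502, §1 (the quantities
  `A, C, D, E, 𝐈`), Lemma 2.5, Remark 3.2, §3 ("by translating in space-time and rescaling").
  [AlbrittonBarker2019]
* G. Koch, N. Nadirashvili, G. Seregin, V. Šverák, Acta Math. 203 (2009) = arXiv:0709.3599, §1
  (the scaling symmetry `u(x,t) ↦ λu(λx, λ²t)`, `p(x,t) ↦ λ²p(λx, λ²t)` only; the paper works at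
  unit viscosity throughout). [KochNadirashviliSereginSverak2009]
* L. Caffarelli, R. Kohn, L. Nirenberg, Comm. Pure Appl. Math. 35 (1982), §1 (the reduction to
  unit viscosity `ν = 1`; tree precedent `SingularSetRescaling.lean`). [CaffarelliKohnNirenberg1982]
* L. Escauriaza, G. Seregin, V. Šverák, Russian Math. Surveys 58 (2003), §3 (parabolic
  rescaling). [EscauriazaSereginSverak2003]
-/

noncomputable section

open MeasureTheory Set Function Filter Topology TopologicalSpace Metric
open scoped NNReal ENNReal

namespace Literature.Analysis.FluidPDE

section AnisotropicRescaling

variable {α β γ : ℝ}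

/-! ### Algebra of the rescaled triple and of its inverse -/

/-- The inverse affine map evaluated: `Φ⁻¹(t, x) = (β⁻¹(t − t₀), γ⁻¹(x − x₀))`, first
component. [folklore] -/
private theorem stAffine_symm_fst (β γ t₀ : ℝ) (x₀ : EuclideanSpace ℝ (Fin 3))
    (z : ℝ × EuclideanSpace ℝ (Fin 3)) :
    (stAffine β⁻¹ γ⁻¹ (-(β⁻¹ * t₀)) (-(γ⁻¹ • x₀)) z).1 = β⁻¹ * (z.1 - t₀) := by
  rw [stAffine_fst]; ring

/-- The inverse affine map evaluated, second component. [folklore] -/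
private theorem stAffine_symm_snd (β γ t₀ : ℝ) (x₀ : EuclideanSpace ℝ (Fin 3))
    (z : ℝ × EuclideanSpace ℝ (Fin 3)) :
    (stAffine β⁻¹ γ⁻¹ (-(β⁻¹ * t₀)) (-(γ⁻¹ • x₀)) z).2 = γ⁻¹ • (z.2 - x₀) := by
  rw [stAffine_snd, smul_sub]; abel

/-- The Jacobian constant of the inverse map: `(β⁻¹ (γ⁻¹)³)⁻¹ = β γ³`. [folklore] -/
private theorem inv_jacobian_symm (β γ : ℝ) : (β⁻¹ * γ⁻¹ ^ 3)⁻¹ = β * γ ^ 3 := by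
  rw [mul_inv, inv_inv, inv_pow, inv_inv]

/-! ### Geometry: the image of a `u`-ball sits in an enlarged `v`-ball -/

/-- The enlargement factor `M = γ⁻¹ + (√β)⁻¹` is positive. [folklore] -/
private theorem enlargement_pos (hβ : 0 < β) (hγ : 0 < γ) : 0 < γ⁻¹ + (Real.sqrt β)⁻¹ :=
  add_pos (inv_pos.2 hγ) (inv_pos.2 (Real.sqrt_pos.2 hβ))

/-- `r² ≤ β (M r)²` for `M = γ⁻¹ + (√β)⁻¹`: the time-length `r²/β` of the image cylinder fits
in the enlarged parabolic ball. [folklore] -/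
private theorem sq_le_mul_enlargement_sq (hβ : 0 < β) (hγ : 0 < γ) (r : ℝ) (hr : 0 ≤ r) :
    β⁻¹ * r ^ 2 ≤ ((γ⁻¹ + (Real.sqrt β)⁻¹) * r) ^ 2 := by
  have hs : 0 < Real.sqrt β := Real.sqrt_pos.2 hβ
  have h1 : (Real.sqrt β)⁻¹ * r ≤ (γ⁻¹ + (Real.sqrt β)⁻¹) * r :=
    mul_le_mul_of_nonneg_right (le_add_of_nonneg_left (inv_nonneg.2 hγ.le)) hr
  have h2 : ((Real.sqrt β)⁻¹ * r) ^ 2 = β⁻¹ * r ^ 2 := by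
    rw [mul_pow, inv_pow, Real.sq_sqrt hβ.le]
  rw [← h2]
  exact pow_le_pow_left₀ (by positivity) h1 2

/-- **The `u`-ball lies in the preimage of the enlarged `v`-ball**:
`Q(z, r) ⊆ Φ'⁻¹(Q(Φ' z, M r))`, `Φ' = Φ⁻¹`, `M = γ⁻¹ + (√β)⁻¹`; equivalently
`Φ⁻¹(Q(z, r)) ⊆ Q(Φ⁻¹ z, M r)`. [folklore] -/
private theorem parabolicCylinder_subset_preimage_symm (hβ : 0 < β) (hγ : 0 < γ) (t₀ : ℝ)
    (x₀ : EuclideanSpace ℝ (Fin 3)) {r : ℝ} (hr : 0 < r) (z : ℝ × EuclideanSpace ℝ (Fin 3)) :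
    parabolicCylinder r z ⊆
      stAffine β⁻¹ γ⁻¹ (-(β⁻¹ * t₀)) (-(γ⁻¹ • x₀)) ⁻¹'
        parabolicCylinder ((γ⁻¹ + (Real.sqrt β)⁻¹) * r)
          (stAffine β⁻¹ γ⁻¹ (-(β⁻¹ * t₀)) (-(γ⁻¹ • x₀)) z) := by
  intro w hw
  rw [mem_parabolicCylinder] at hw
  obtain ⟨⟨h1, h2⟩, h3⟩ := hw
  have hM := sq_le_mul_enlargement_sq hβ hγ r hr.le
  rw [mem_preimage, mem_parabolicCylinder, stAffine_symm_fst, stAffine_symm_fst,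
    stAffine_symm_snd, stAffine_symm_snd]
  refine ⟨⟨?_, ?_⟩, ?_⟩
  · have h4 : β⁻¹ * (z.1 - t₀) - β⁻¹ * (w.1 - t₀) = β⁻¹ * (z.1 - w.1) := by ring
    have h5 : β⁻¹ * (z.1 - w.1) < β⁻¹ * r ^ 2 := mul_lt_mul_of_pos_left (by linarith) (inv_pos.2 hβ)
    linarith
  · exact mul_lt_mul_of_pos_left (by linarith) (inv_pos.2 hβ)
  · rw [dist_eq_norm, ← smul_sub, sub_sub_sub_cancel_right, norm_smul, Real.norm_eq_abs,
      abs_of_pos (inv_pos.2 hγ), ← dist_eq_norm]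
    calc γ⁻¹ * dist w.2 z.2 < γ⁻¹ * r := mul_lt_mul_of_pos_left h3 (inv_pos.2 hγ)
      _ ≤ (γ⁻¹ + (Real.sqrt β)⁻¹) * r :=
          mul_le_mul_of_nonneg_right (le_add_of_nonneg_right
            (inv_nonneg.2 (Real.sqrt_nonneg _))) hr.le

/-- **Apex containment.** If `Q(z, r) ⊆ Q((t₀, x₀), r₀)` (a ball inside the apex region of the
`u`-frame) and `r₀ (γ⁻¹ + 2(√β)⁻¹) ≤ ρ`, then the enlarged preimage ball lies in the ball
`Q(0, ρ)` of the `v`-frame: `Q(Φ⁻¹ z, M r) ⊆ Q(0, ρ)`. [folklore] -/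
private theorem parabolicCylinder_symm_subset_of_apex (hβ : 0 < β) (hγ : 0 < γ) {t₀ : ℝ}
    {x₀ : EuclideanSpace ℝ (Fin 3)} {r r₀ ρ : ℝ} (hr : 0 < r) {z : ℝ × EuclideanSpace ℝ (Fin 3)}
    (hz : parabolicCylinder r z ⊆ parabolicCylinder r₀ ((t₀, x₀) : ℝ × EuclideanSpace ℝ (Fin 3)))
    (hρ : r₀ * (γ⁻¹ + 2 * (Real.sqrt β)⁻¹) ≤ ρ) :
    parabolicCylinder ((γ⁻¹ + (Real.sqrt β)⁻¹) * r)
        (stAffine β⁻¹ γ⁻¹ (-(β⁻¹ * t₀)) (-(γ⁻¹ • x₀)) z) ⊆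
      parabolicCylinder ρ (0 : ℝ × EuclideanSpace ℝ (Fin 3)) := by
  obtain ⟨h1, h2, h3⟩ := AlbrittonBarker2019.margins_of_parabolicCylinder_subset hr hz
  simp only at h1 h2 h3
  have hs : 0 < Real.sqrt β := Real.sqrt_pos.2 hβ
  have hsi : 0 < (Real.sqrt β)⁻¹ := inv_pos.2 hs
  have hgi : 0 < γ⁻¹ := inv_pos.2 hγ
  have hbi : 0 < β⁻¹ := inv_pos.2 hβ
  have hd : 0 ≤ dist z.2 x₀ := dist_nonneg
  have hrr₀ : r ≤ r₀ := by linarith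
  have hr₀ : 0 ≤ r₀ := hr.le.trans hrr₀
  refine AlbrittonBarker2019.parabolicCylinder_subset_of_margins' ?_ ?_ ?_
  · rw [stAffine_symm_fst]
    show β⁻¹ * (z.1 - t₀) ≤ 0
    have : β⁻¹ * (z.1 - t₀) = -(β⁻¹ * (t₀ - z.1)) := by ring
    rw [this, neg_nonpos]
    exact mul_nonneg hbi.le (by linarith)
  · rw [stAffine_symm_fst]
    show (0 : ℝ) - ρ ^ 2 ≤ β⁻¹ * (z.1 - t₀) - ((γ⁻¹ + (Real.sqrt β)⁻¹) * r) ^ 2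
    -- `-ρ² ≤ β⁻¹ (t - t₀) - (M r)²`, from `t - r² ≥ t₀ - r₀²`, `r ≤ r₀`, `r₀ (γ⁻¹ + 2/√β) ≤ ρ`
    have h4 : β⁻¹ * (r₀ ^ 2 - r ^ 2) + ((γ⁻¹ + (Real.sqrt β)⁻¹) * r) ^ 2 ≤
        (r₀ * (γ⁻¹ + 2 * (Real.sqrt β)⁻¹)) ^ 2 := by
      have h5 : ((γ⁻¹ + (Real.sqrt β)⁻¹) * r) ^ 2 ≤ ((γ⁻¹ + (Real.sqrt β)⁻¹) * r₀) ^ 2 :=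
        pow_le_pow_left₀ (by positivity) (mul_le_mul_of_nonneg_left hrr₀ (by positivity)) 2
      have h6 : β⁻¹ * (r₀ ^ 2 - r ^ 2) ≤ β⁻¹ * r₀ ^ 2 :=
        mul_le_mul_of_nonneg_left (by nlinarith) hbi.le
      have hsq : (Real.sqrt β)⁻¹ ^ 2 = β⁻¹ := by rw [inv_pow, Real.sq_sqrt hβ.le]
      have h5' : ((γ⁻¹ + (Real.sqrt β)⁻¹) * r₀) ^ 2 + β⁻¹ * r₀ ^ 2 ≤
          (r₀ * (γ⁻¹ + 2 * (Real.sqrt β)⁻¹)) ^ 2 := by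
        rw [← hsq]
        nlinarith [mul_nonneg hgi.le hsi.le, sq_nonneg r₀, sq_nonneg (Real.sqrt β)⁻¹]
      linarith
    have h7 : (r₀ * (γ⁻¹ + 2 * (Real.sqrt β)⁻¹)) ^ 2 ≤ ρ ^ 2 :=
      pow_le_pow_left₀ (by positivity) hρ 2
    have h8 : β⁻¹ * (t₀ - z.1) ≤ β⁻¹ * (r₀ ^ 2 - r ^ 2) :=
      mul_le_mul_of_nonneg_left (by linarith) hbi.le
    have e : β⁻¹ * (z.1 - t₀) = -(β⁻¹ * (t₀ - z.1)) := by ring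
    rw [e]
    linarith
  · rw [stAffine_symm_snd, Prod.snd_zero, dist_zero_right, norm_smul, Real.norm_eq_abs,
      abs_of_pos hgi, ← dist_eq_norm, add_mul]
    have h9 : γ⁻¹ * dist z.2 x₀ ≤ γ⁻¹ * r₀ - γ⁻¹ * r := by
      rw [← mul_sub]; exact mul_le_mul_of_nonneg_left (by linarith) hgi.le
    have h10 : (Real.sqrt β)⁻¹ * r ≤ (Real.sqrt β)⁻¹ * r₀ := mul_le_mul_of_nonneg_left hrr₀ hsi.le
    have hρ' : γ⁻¹ * r₀ + 2 * ((Real.sqrt β)⁻¹ * r₀) ≤ ρ := by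
      calc γ⁻¹ * r₀ + 2 * ((Real.sqrt β)⁻¹ * r₀) = r₀ * (γ⁻¹ + 2 * (Real.sqrt β)⁻¹) := by ring
        _ ≤ ρ := hρ
    nlinarith [mul_nonneg hsi.le hr₀]

/-! ### Bookkeeping of constants -/

/-- `(r²)⁻¹ K = (K M²) ((M r)²)⁻¹` in `ℝ≥0∞`, for `r, M > 0`, `K ≥ 0`. [folklore] -/
private theorem inv_ofReal_sq_mul_ofReal_eq_enlarge {r M K : ℝ} (hr : 0 < r) (hM : 0 < M)
    (hK : 0 ≤ K) :
    (ENNReal.ofReal r ^ 2)⁻¹ * ENNReal.ofReal K =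
      ENNReal.ofReal (K * M ^ 2) * (ENNReal.ofReal (M * r) ^ 2)⁻¹ := by
  rw [← ENNReal.ofReal_pow hr.le, ← ENNReal.ofReal_pow (by positivity : 0 ≤ M * r),
    ← ENNReal.ofReal_inv_of_pos (by positivity), ← ENNReal.ofReal_inv_of_pos (by positivity),
    ← ENNReal.ofReal_mul (by positivity), ← ENNReal.ofReal_mul (by positivity)]
  congr 1
  field_simp

/-- `r⁻¹ K = (K M) (M r)⁻¹` in `ℝ≥0∞`, for `r, M > 0`, `K ≥ 0`. [folklore] -/
private theorem inv_ofReal_mul_ofReal_eq_enlarge {r M K : ℝ} (hr : 0 < r) (hM : 0 < M)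
    (hK : 0 ≤ K) :
    (ENNReal.ofReal r)⁻¹ * ENNReal.ofReal K =
      ENNReal.ofReal (K * M) * (ENNReal.ofReal (M * r))⁻¹ := by
  rw [← ENNReal.ofReal_inv_of_pos hr, ← ENNReal.ofReal_inv_of_pos (by positivity),
    ← ENNReal.ofReal_mul (by positivity), ← ENNReal.ofReal_mul (by positivity)]
  congr 1
  field_simp

/-- The Jacobian factor of the inverse map in `ℝ≥0∞`: `((β⁻¹ (γ⁻¹)^{dim}))⁻¹ = β γ³` on
`ℝ³`. [folklore] -/
private theorem ofReal_inv_jacobian_symm (β γ : ℝ) :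
    ENNReal.ofReal (β⁻¹ * γ⁻¹ ^ Module.finrank ℝ (EuclideanSpace ℝ (Fin 3)))⁻¹ =
      ENNReal.ofReal (β * γ ^ 3) := by
  rw [finrank_euclideanSpace_fin, inv_jacobian_symm]

/-! ### The comparisons, quantity by quantity -/

/-- **`C` under the anisotropic rescaling**: with `v = α • (u ∘ Φ)`,
`Φ(s, y) = (t₀ + β s, x₀ + γ y)`, `M = γ⁻¹ + (√β)⁻¹` and `z' = Φ⁻¹ z`,
`C(Q(z, r); u) ≤ α⁻³ β γ³ M² · C(Q(z', M r); v)` (change of variables `dz = β γ³ dz'` on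
`Φ⁻¹(Q(z, r)) ⊆ Q(z', M r)`). (The `ν`-normalising,
anisotropic case is folklore bookkeeping; the printed, parabolic case is the cited reduction.)
[cite: AlbrittonBarker2019, §1 (A, C, D, E, 𝐈 after Thm 1.1); §3, proof of Thm 3.1 (rescaling)] -/
theorem cknC_le_mul_cknC_stRescale (hα : 0 < α) (hβ : 0 < β) (hγ : 0 < γ) (t₀ : ℝ)
    (x₀ : EuclideanSpace ℝ (Fin 3)) {r : ℝ} (hr : 0 < r) (z : ℝ × EuclideanSpace ℝ (Fin 3))
    (u : ℝ → EuclideanSpace ℝ (Fin 3) → EuclideanSpace ℝ (Fin 3)) :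
    cknC r z u ≤
      ENNReal.ofReal (α⁻¹ ^ 3 * (β * γ ^ 3) * (γ⁻¹ + (Real.sqrt β)⁻¹) ^ 2) *
        cknC ((γ⁻¹ + (Real.sqrt β)⁻¹) * r) (stAffine β⁻¹ γ⁻¹ (-(β⁻¹ * t₀)) (-(γ⁻¹ • x₀)) z)
          (α • stPull β γ t₀ x₀ u) := by
  set M : ℝ := γ⁻¹ + (Real.sqrt β)⁻¹ with hM
  set z' := stAffine β⁻¹ γ⁻¹ (-(β⁻¹ * t₀)) (-(γ⁻¹ • x₀)) z with hz'
  set v := α • stPull β γ t₀ x₀ u with hv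
  have hMpos : 0 < M := enlargement_pos hβ hγ
  have hβ' : 0 < β⁻¹ := inv_pos.2 hβ
  have hγ' : 0 < γ⁻¹ := inv_pos.2 hγ
  have hid : α⁻¹ • stPull β⁻¹ γ⁻¹ (-(β⁻¹ * t₀)) (-(γ⁻¹ • x₀)) v = u :=
    inv_smul_stPull_symm_smul_stPull hα.ne' hβ.ne' hγ.ne' t₀ x₀ u
  have hsub := parabolicCylinder_subset_preimage_symm hβ hγ t₀ x₀ hr z
  have key : ∫⁻ w in parabolicCylinder r z, ‖u w.1 w.2‖ₑ ^ (3 : ℕ) ≤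
      ENNReal.ofReal (α⁻¹ ^ 3 * (β * γ ^ 3)) *
        ∫⁻ w in parabolicCylinder (M * r) z', ‖v w.1 w.2‖ₑ ^ (3 : ℕ) := by
    have h1 := setLIntegral_enorm_pow_stRescale (E := EuclideanSpace ℝ (Fin 3)) hβ' hγ'
      (-(β⁻¹ * t₀)) (-(γ⁻¹ • x₀)) α⁻¹ v (parabolicCylinder (M * r) z') 3
    rw [hid, ofReal_inv_jacobian_symm, Real.enorm_eq_ofReal (inv_nonneg.2 hα.le),
      ← ENNReal.ofReal_pow (inv_nonneg.2 hα.le), ← ENNReal.ofReal_mul (by positivity)] at h1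
    rw [← h1]
    exact lintegral_mono_set hsub
  calc cknC r z u
      = (ENNReal.ofReal r ^ 2)⁻¹ * ∫⁻ w in parabolicCylinder r z, ‖u w.1 w.2‖ₑ ^ (3 : ℕ) := rfl
    _ ≤ (ENNReal.ofReal r ^ 2)⁻¹ * (ENNReal.ofReal (α⁻¹ ^ 3 * (β * γ ^ 3)) *
        ∫⁻ w in parabolicCylinder (M * r) z', ‖v w.1 w.2‖ₑ ^ (3 : ℕ)) := mul_le_mul' le_rfl key
    _ = (ENNReal.ofReal r ^ 2)⁻¹ * ENNReal.ofReal (α⁻¹ ^ 3 * (β * γ ^ 3)) *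
        ∫⁻ w in parabolicCylinder (M * r) z', ‖v w.1 w.2‖ₑ ^ (3 : ℕ) := (mul_assoc _ _ _).symm
    _ = ENNReal.ofReal (α⁻¹ ^ 3 * (β * γ ^ 3) * M ^ 2) * (ENNReal.ofReal (M * r) ^ 2)⁻¹ *
        ∫⁻ w in parabolicCylinder (M * r) z', ‖v w.1 w.2‖ₑ ^ (3 : ℕ) := by
        rw [inv_ofReal_sq_mul_ofReal_eq_enlarge hr hMpos (by positivity)]
    _ = ENNReal.ofReal (α⁻¹ ^ 3 * (β * γ ^ 3) * M ^ 2) * ((ENNReal.ofReal (M * r) ^ 2)⁻¹ *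
        ∫⁻ w in parabolicCylinder (M * r) z', ‖v w.1 w.2‖ₑ ^ (3 : ℕ)) := mul_assoc _ _ _
    _ = _ := rfl

/-- **`E` under the anisotropic rescaling**: with `∇v = (α γ) • ((∇u) ∘ Φ)`,
`E(Q(z, r); ∇u) ≤ (α γ)⁻² β γ³ M · E(Q(z', M r); ∇v)`. (The `ν`-normalising,
anisotropic case is folklore bookkeeping; the printed, parabolic case is the cited reduction.)
[cite: AlbrittonBarker2019, §1 (A, C, D, E, 𝐈 after Thm 1.1); §3, proof of Thm 3.1 (rescaling)] -/
theorem cknE_le_mul_cknE_stRescale (hα : 0 < α) (hβ : 0 < β) (hγ : 0 < γ) (t₀ : ℝ)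
    (x₀ : EuclideanSpace ℝ (Fin 3)) {r : ℝ} (hr : 0 < r) (z : ℝ × EuclideanSpace ℝ (Fin 3))
    (G : ℝ → EuclideanSpace ℝ (Fin 3) → EuclideanSpace ℝ (Fin 3) →L[ℝ] EuclideanSpace ℝ (Fin 3)) :
    cknE r z G ≤
      ENNReal.ofReal ((α * γ)⁻¹ ^ 2 * (β * γ ^ 3) * (γ⁻¹ + (Real.sqrt β)⁻¹)) *
        cknE ((γ⁻¹ + (Real.sqrt β)⁻¹) * r) (stAffine β⁻¹ γ⁻¹ (-(β⁻¹ * t₀)) (-(γ⁻¹ • x₀)) z)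
          ((α * γ) • stPull β γ t₀ x₀ G) := by
  set M : ℝ := γ⁻¹ + (Real.sqrt β)⁻¹ with hM
  set z' := stAffine β⁻¹ γ⁻¹ (-(β⁻¹ * t₀)) (-(γ⁻¹ • x₀)) z with hz'
  set Gv := (α * γ) • stPull β γ t₀ x₀ G with hGv
  have hMpos : 0 < M := enlargement_pos hβ hγ
  have hβ' : 0 < β⁻¹ := inv_pos.2 hβ
  have hγ' : 0 < γ⁻¹ := inv_pos.2 hγ
  have hαγ : 0 < α * γ := mul_pos hα hγ
  have hid : (α * γ)⁻¹ • stPull β⁻¹ γ⁻¹ (-(β⁻¹ * t₀)) (-(γ⁻¹ • x₀)) Gv = G :=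
    inv_smul_stPull_symm_smul_stPull hαγ.ne' hβ.ne' hγ.ne' t₀ x₀ G
  have hsub := parabolicCylinder_subset_preimage_symm hβ hγ t₀ x₀ hr z
  have key : ∫⁻ w in parabolicCylinder r z, ENNReal.ofReal (frobeniusNormSq (G w.1 w.2)) ≤
      ENNReal.ofReal ((α * γ)⁻¹ ^ 2 * (β * γ ^ 3)) *
        ∫⁻ w in parabolicCylinder (M * r) z', ENNReal.ofReal (frobeniusNormSq (Gv w.1 w.2)) := by
    have h1 := setLIntegral_frobeniusNormSq_stRescale (E := EuclideanSpace ℝ (Fin 3)) hβ' hγ'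
      (-(β⁻¹ * t₀)) (-(γ⁻¹ • x₀)) (α * γ)⁻¹ Gv (parabolicCylinder (M * r) z')
    rw [hid, ofReal_inv_jacobian_symm, ← ENNReal.ofReal_mul (by positivity)] at h1
    rw [← h1]
    exact lintegral_mono_set hsub
  calc cknE r z G
      = (ENNReal.ofReal r)⁻¹ *
          ∫⁻ w in parabolicCylinder r z, ENNReal.ofReal (frobeniusNormSq (G w.1 w.2)) := rfl
    _ ≤ (ENNReal.ofReal r)⁻¹ * (ENNReal.ofReal ((α * γ)⁻¹ ^ 2 * (β * γ ^ 3)) *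
        ∫⁻ w in parabolicCylinder (M * r) z', ENNReal.ofReal (frobeniusNormSq (Gv w.1 w.2))) :=
        mul_le_mul' le_rfl key
    _ = (ENNReal.ofReal r)⁻¹ * ENNReal.ofReal ((α * γ)⁻¹ ^ 2 * (β * γ ^ 3)) *
        ∫⁻ w in parabolicCylinder (M * r) z', ENNReal.ofReal (frobeniusNormSq (Gv w.1 w.2)) :=
        (mul_assoc _ _ _).symm
    _ = ENNReal.ofReal ((α * γ)⁻¹ ^ 2 * (β * γ ^ 3) * M) * (ENNReal.ofReal (M * r))⁻¹ *
        ∫⁻ w in parabolicCylinder (M * r) z', ENNReal.ofReal (frobeniusNormSq (Gv w.1 w.2)) := by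
        rw [inv_ofReal_mul_ofReal_eq_enlarge hr hMpos (by positivity)]
    _ = ENNReal.ofReal ((α * γ)⁻¹ ^ 2 * (β * γ ^ 3) * M) * ((ENNReal.ofReal (M * r))⁻¹ *
        ∫⁻ w in parabolicCylinder (M * r) z', ENNReal.ofReal (frobeniusNormSq (Gv w.1 w.2))) :=
        mul_assoc _ _ _
    _ = _ := rfl

/-- **`A` under the anisotropic rescaling**: `A(Q(z, r); u) ≤ α⁻² γ³ M · A(Q(z', M r); v)`
(slice by slice: the spatial change of variables `dx = γ³ dy` on `B(x, r) ⊆ A(B(y', M r))`,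
`A y = x₀ + γ y`, and transport of the essential supremum along the time-affine map, the
`u`-window `(t − r², t)` being carried INTO the `v`-window `(s' − (M r)², s')`).
(The `ν`-normalising, anisotropic case is folklore bookkeeping; the printed, parabolic case is the
cited reduction.)
[cite: AlbrittonBarker2019, §1 (A, C, D, E, 𝐈 after Thm 1.1); §3, proof of Thm 3.1 (rescaling)] -/
theorem cknAEss_le_mul_cknAEss_stRescale (hα : 0 < α) (hβ : 0 < β) (hγ : 0 < γ) (t₀ : ℝ)
    (x₀ : EuclideanSpace ℝ (Fin 3)) {r : ℝ} (hr : 0 < r) (z : ℝ × EuclideanSpace ℝ (Fin 3))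
    (u : ℝ → EuclideanSpace ℝ (Fin 3) → EuclideanSpace ℝ (Fin 3)) :
    cknAEss r z u ≤
      ENNReal.ofReal (α⁻¹ ^ 2 * γ ^ 3 * (γ⁻¹ + (Real.sqrt β)⁻¹)) *
        cknAEss ((γ⁻¹ + (Real.sqrt β)⁻¹) * r) (stAffine β⁻¹ γ⁻¹ (-(β⁻¹ * t₀)) (-(γ⁻¹ • x₀)) z)
          (α • stPull β γ t₀ x₀ u) := by
  set M : ℝ := γ⁻¹ + (Real.sqrt β)⁻¹ with hM
  set z' := stAffine β⁻¹ γ⁻¹ (-(β⁻¹ * t₀)) (-(γ⁻¹ • x₀)) z with hz'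
  set v := α • stPull β γ t₀ x₀ u with hv
  have hMpos : 0 < M := enlargement_pos hβ hγ
  have hr' : 0 < M * r := mul_pos hMpos hr
  have hβ' : 0 < β⁻¹ := inv_pos.2 hβ
  have hγ' : 0 < γ⁻¹ := inv_pos.2 hγ
  have hid : α⁻¹ • stPull β⁻¹ γ⁻¹ (-(β⁻¹ * t₀)) (-(γ⁻¹ • x₀)) v = u :=
    inv_smul_stPull_symm_smul_stPull hα.ne' hβ.ne' hγ.ne' t₀ x₀ u
  have hux : ∀ t x, u t x = α⁻¹ • v (-(β⁻¹ * t₀) + β⁻¹ * t) (-(γ⁻¹ • x₀) + γ⁻¹ • x) := by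
    intro t x
    have h := congrFun (congrFun hid t) x
    rw [smul_stPull_apply] at h
    exact h.symm
  -- the `v`-side slice functional
  set h : ℝ → ℝ≥0∞ := fun s =>
    (ENNReal.ofReal (M * r))⁻¹ * ∫⁻ y in ball z'.2 (M * r), ‖v s y‖ₑ ^ 2 with hh
  set K : ℝ≥0∞ := ENNReal.ofReal (α⁻¹ ^ 2 * γ ^ 3 * M) with hK
  -- Step 1: slice comparison, for EVERY `u`-time `t`
  have slice : ∀ t : ℝ, (ENNReal.ofReal r)⁻¹ * ∫⁻ x in ball z.2 r, ‖u t x‖ₑ ^ 2 ≤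
      K * h (-(β⁻¹ * t₀) + β⁻¹ * t) := by
    intro t
    set s : ℝ := -(β⁻¹ * t₀) + β⁻¹ * t with hs
    set F : EuclideanSpace ℝ (Fin 3) → ℝ≥0∞ := fun y => ‖α⁻¹‖ₑ ^ 2 * ‖v s y‖ₑ ^ 2 with hF
    have hint : (fun x => ‖u t x‖ₑ ^ 2) = fun x => F (-(γ⁻¹ • x₀) + γ⁻¹ • x) := by
      funext x
      rw [hux t x, hF, enorm_smul, mul_pow]
    have hball : ball z.2 r ⊆
        (fun x : EuclideanSpace ℝ (Fin 3) => -(γ⁻¹ • x₀) + γ⁻¹ • x) ⁻¹' ball z'.2 (M * r) := by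
      intro x hx
      rw [mem_preimage, mem_ball, hz', stAffine_snd, dist_eq_norm, add_sub_add_left_eq_sub,
        ← smul_sub, norm_smul, Real.norm_eq_abs, abs_of_pos hγ', ← dist_eq_norm]
      rw [mem_ball] at hx
      calc γ⁻¹ * dist x z.2 < γ⁻¹ * r := mul_lt_mul_of_pos_left hx hγ'
        _ ≤ M * r := mul_le_mul_of_nonneg_right
            (le_add_of_nonneg_right (inv_nonneg.2 (Real.sqrt_nonneg _))) hr.le
    have h1 : ∫⁻ x in ball z.2 r, ‖u t x‖ₑ ^ 2 ≤
        ENNReal.ofReal (α⁻¹ ^ 2 * γ ^ 3) * ∫⁻ y in ball z'.2 (M * r), ‖v s y‖ₑ ^ 2 := by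
      have h2 := setLIntegral_preimage_comp_space_affine (E := EuclideanSpace ℝ (Fin 3)) hγ'
        (-(γ⁻¹ • x₀)) F (ball z'.2 (M * r))
      rw [finrank_euclideanSpace_fin, inv_pow, inv_inv] at h2
      calc ∫⁻ x in ball z.2 r, ‖u t x‖ₑ ^ 2
          = ∫⁻ x in ball z.2 r, F (-(γ⁻¹ • x₀) + γ⁻¹ • x) := by rw [hint]
        _ ≤ ∫⁻ x in (fun x : EuclideanSpace ℝ (Fin 3) => -(γ⁻¹ • x₀) + γ⁻¹ • x) ⁻¹'
              ball z'.2 (M * r), F (-(γ⁻¹ • x₀) + γ⁻¹ • x) := lintegral_mono_set hball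
        _ = ENNReal.ofReal (γ ^ 3) * ∫⁻ y in ball z'.2 (M * r), F y := h2
        _ = ENNReal.ofReal (α⁻¹ ^ 2 * γ ^ 3) * ∫⁻ y in ball z'.2 (M * r), ‖v s y‖ₑ ^ 2 := by
              rw [hF, lintegral_const_mul' _ _ (by simp), ← mul_assoc,
                Real.enorm_eq_ofReal (inv_nonneg.2 hα.le),
                ← ENNReal.ofReal_pow (inv_nonneg.2 hα.le), ← ENNReal.ofReal_mul (by positivity),
                mul_comm (γ ^ 3)]
    calc (ENNReal.ofReal r)⁻¹ * ∫⁻ x in ball z.2 r, ‖u t x‖ₑ ^ 2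
        ≤ (ENNReal.ofReal r)⁻¹ * (ENNReal.ofReal (α⁻¹ ^ 2 * γ ^ 3) *
            ∫⁻ y in ball z'.2 (M * r), ‖v s y‖ₑ ^ 2) := mul_le_mul' le_rfl h1
      _ = (ENNReal.ofReal r)⁻¹ * ENNReal.ofReal (α⁻¹ ^ 2 * γ ^ 3) *
            ∫⁻ y in ball z'.2 (M * r), ‖v s y‖ₑ ^ 2 := (mul_assoc _ _ _).symm
      _ = ENNReal.ofReal (α⁻¹ ^ 2 * γ ^ 3 * M) * (ENNReal.ofReal (M * r))⁻¹ *
            ∫⁻ y in ball z'.2 (M * r), ‖v s y‖ₑ ^ 2 := by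
          rw [inv_ofReal_mul_ofReal_eq_enlarge hr hMpos (by positivity)]
      _ = K * h s := by rw [hK, hh, mul_assoc]
  -- Step 2: transport of the essential supremum
  have hwin : Ioo (-(β⁻¹ * t₀) + β⁻¹ * (z.1 - r ^ 2)) (-(β⁻¹ * t₀) + β⁻¹ * z.1) ⊆
      Ioo (z'.1 - (M * r) ^ 2) z'.1 := by
    have e1 : z'.1 = -(β⁻¹ * t₀) + β⁻¹ * z.1 := by rw [hz', stAffine_fst]
    have e2 := sq_le_mul_enlargement_sq hβ hγ r hr.le
    refine Ioo_subset_Ioo ?_ (le_of_eq e1.symm)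
    rw [e1]
    nlinarith
  have hac : (volume.restrict (Ioo (-(β⁻¹ * t₀) + β⁻¹ * (z.1 - r ^ 2)) (-(β⁻¹ * t₀) + β⁻¹ * z.1))
      : Measure ℝ) ≪ volume.restrict (Ioo (z'.1 - (M * r) ^ 2) z'.1) :=
    Measure.absolutelyContinuous_of_le (Measure.restrict_mono hwin le_rfl)
  calc cknAEss r z u
      = essSup (fun t => (ENNReal.ofReal r)⁻¹ * ∫⁻ x in ball z.2 r, ‖u t x‖ₑ ^ 2)
          (volume.restrict (Ioo (z.1 - r ^ 2) z.1)) := rfl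
    _ ≤ essSup (fun t => K * h (-(β⁻¹ * t₀) + β⁻¹ * t))
          (volume.restrict (Ioo (z.1 - r ^ 2) z.1)) :=
        essSup_mono_ae (Eventually.of_forall slice)
    _ = essSup (fun s => K * h s)
          (volume.restrict (Ioo (-(β⁻¹ * t₀) + β⁻¹ * (z.1 - r ^ 2)) (-(β⁻¹ * t₀) + β⁻¹ * z.1))) :=
        essSup_comp_time_affine hβ' (-(β⁻¹ * t₀)) (z.1 - r ^ 2) z.1 (fun s => K * h s)
    _ ≤ essSup (fun s => K * h s) (volume.restrict (Ioo (z'.1 - (M * r) ^ 2) z'.1)) :=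
        essSup_mono_measure hac
    _ ≤ K * essSup h (volume.restrict (Ioo (z'.1 - (M * r) ^ 2) z'.1)) := by
        refine essSup_le_of_ae_le _ ?_
        filter_upwards [ENNReal.ae_le_essSup h] with s hs
        exact mul_le_mul' le_rfl hs
    _ = _ := rfl

/-- **`D` under the anisotropic rescaling**: for the UN-gauged `u`-side pressure `p` and the
gauged, rescaled `v`-side pressure `π = α² • ((p − c(t)) ∘ Φ)`,
`D(Q(z, r); p) ≤ 4 α⁻³ β γ³ M² · D(Q(z', M r); π)`. The ball mean on the right is over the
enlarged ball `B(y', M r)`; on the left the mean over `B(x, r)` is first replaced by the pull-back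
of that mean plus the gauge (`D` does not see functions of time, `cknDOsc_sub_fun_time` — this is
where the slice integrability of `p` enters), then by the plain quantity
(`cknDOsc_le_four_mul_cknD` — this is where the measurability of `π` enters), and the change of
variables is performed on the plain quantity. (The `ν`-normalising,
anisotropic case is folklore bookkeeping; the printed, parabolic case is the cited reduction.)
[cite: AlbrittonBarker2019, §1 (A, C, D, E, 𝐈 after Thm 1.1); §3, proof of Thm 3.1 (rescaling)] -/
theorem cknDOsc_le_mul_cknDOsc_stRescale (hα : 0 < α) (hβ : 0 < β) (hγ : 0 < γ) (t₀ : ℝ)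
    (x₀ : EuclideanSpace ℝ (Fin 3)) {r : ℝ} (hr : 0 < r) (z : ℝ × EuclideanSpace ℝ (Fin 3))
    {p : ℝ → EuclideanSpace ℝ (Fin 3) → ℝ} (c : ℝ → ℝ)
    (hp : ∀ᵐ t ∂(volume.restrict (Ioo (z.1 - r ^ 2) z.1)), IntegrableOn (p t) (ball z.2 r) volume)
    (hπ : AEStronglyMeasurable (uncurry (α ^ 2 • stPull β γ t₀ x₀ (fun t x => p t x - c t)))
      (volume.restrict (parabolicCylinder ((γ⁻¹ + (Real.sqrt β)⁻¹) * r)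
        (stAffine β⁻¹ γ⁻¹ (-(β⁻¹ * t₀)) (-(γ⁻¹ • x₀)) z)))) :
    cknDOsc r z p ≤
      ENNReal.ofReal (4 * (α⁻¹ ^ 3 * (β * γ ^ 3)) * (γ⁻¹ + (Real.sqrt β)⁻¹) ^ 2) *
        cknDOsc ((γ⁻¹ + (Real.sqrt β)⁻¹) * r) (stAffine β⁻¹ γ⁻¹ (-(β⁻¹ * t₀)) (-(γ⁻¹ • x₀)) z)
          (α ^ 2 • stPull β γ t₀ x₀ (fun t x => p t x - c t)) := by
  set M : ℝ := γ⁻¹ + (Real.sqrt β)⁻¹ with hM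
  set z' := stAffine β⁻¹ γ⁻¹ (-(β⁻¹ * t₀)) (-(γ⁻¹ • x₀)) z with hz'
  set π : ℝ → EuclideanSpace ℝ (Fin 3) → ℝ :=
    α ^ 2 • stPull β γ t₀ x₀ (fun t x => p t x - c t) with hπdef
  have hMpos : 0 < M := enlargement_pos hβ hγ
  have hr' : 0 < M * r := mul_pos hMpos hr
  have hβ' : 0 < β⁻¹ := inv_pos.2 hβ
  have hγ' : 0 < γ⁻¹ := inv_pos.2 hγ
  have hα2 : 0 < α ^ 2 := by positivity
  have hsub := parabolicCylinder_subset_preimage_symm hβ hγ t₀ x₀ hr z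
  -- the `v`-side ball mean and the mean-free pressure
  set m : ℝ → ℝ := fun s => ⨍ y in ball z'.2 (M * r), π s y with hm
  set Ψ : ℝ → EuclideanSpace ℝ (Fin 3) → ℝ := fun s y => π s y - m s with hΨ
  -- the `u`-side gauge absorbing `c` and the pulled-back mean
  set k : ℝ → ℝ := fun t => c t + (α ^ 2)⁻¹ * m (-(β⁻¹ * t₀) + β⁻¹ * t) with hk
  -- `p − k = (α²)⁻¹ • (Ψ ∘ Φ⁻¹)`
  have hid : (fun t x => p t x - k t) =
      (α ^ 2)⁻¹ • stPull β⁻¹ γ⁻¹ (-(β⁻¹ * t₀)) (-(γ⁻¹ • x₀)) Ψ := by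
    funext t x
    have ht : t₀ + β * (-(β⁻¹ * t₀) + β⁻¹ * t) = t := by field_simp; ring
    have hx : x₀ + γ • (-(γ⁻¹ • x₀) + γ⁻¹ • x) = x := by
      rw [smul_add, smul_neg, smul_smul, smul_smul, mul_inv_cancel₀ hγ.ne', one_smul, one_smul]
      abel
    rw [smul_stPull_apply, hΨ]
    simp only [hπdef, smul_stPull_apply, smul_eq_mul, ht, hx, hk]
    field_simp
    ring
  -- measurability of `p − k` on `Q(z, r)`, transported from that of `π` on `Q(z', M r)`
  have hmean : AEStronglyMeasurable
      (fun w : ℝ × EuclideanSpace ℝ (Fin 3) => ⨍ y in ball z'.2 (M * r), π w.1 y)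
      (volume.restrict (parabolicCylinder (M * r) z')) :=
    aestronglyMeasurable_setAverage_slice hπ
  have hΨm : AEStronglyMeasurable (uncurry Ψ) (volume.restrict (parabolicCylinder (M * r) z')) :=
    (hπ.sub hmean).congr (Eventually.of_forall fun w => rfl)
  have hmeas : AEStronglyMeasurable (uncurry fun t x => p t x - k t)
      (volume.restrict (parabolicCylinder r z)) := by
    rw [hid]
    have hmap := map_stAffine_volume_restrict_preimage (E := EuclideanSpace ℝ (Fin 3)) hβ' hγ'
      (-(β⁻¹ * t₀)) (-(γ⁻¹ • x₀)) (parabolicCylinder (M * r) z')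
    have h1 : AEStronglyMeasurable (uncurry Ψ)
        (Measure.map (stAffine β⁻¹ γ⁻¹ (-(β⁻¹ * t₀)) (-(γ⁻¹ • x₀)))
          (volume.restrict (stAffine β⁻¹ γ⁻¹ (-(β⁻¹ * t₀)) (-(γ⁻¹ • x₀)) ⁻¹'
            parabolicCylinder (M * r) z'))) := by
      rw [hmap]; exact hΨm.smul_measure _
    have h2 := (h1.comp_measurable (measurable_stAffine _ _ _ _)).mono_measure
      (Measure.restrict_mono hsub le_rfl)
    have h3 : uncurry ((α ^ 2)⁻¹ • stPull β⁻¹ γ⁻¹ (-(β⁻¹ * t₀)) (-(γ⁻¹ • x₀)) Ψ) =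
        fun w => (α ^ 2)⁻¹ • (uncurry Ψ ∘ stAffine β⁻¹ γ⁻¹ (-(β⁻¹ * t₀)) (-(γ⁻¹ • x₀))) w := by
      funext w; rfl
    rw [h3]
    exact h2.fun_const_smul ((α ^ 2)⁻¹ : ℝ)
  -- the change of variables on the plain quantity
  have key : ∫⁻ w in parabolicCylinder r z, ‖p w.1 w.2 - k w.1‖ₑ ^ (3 / 2 : ℝ) ≤
      ENNReal.ofReal ((α ^ 2)⁻¹ ^ (3 / 2 : ℝ) * (β * γ ^ 3)) *
        ∫⁻ w in parabolicCylinder (M * r) z', ‖Ψ w.1 w.2‖ₑ ^ (3 / 2 : ℝ) := by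
    have h1 := setLIntegral_enorm_rpow_stRescale (E := EuclideanSpace ℝ (Fin 3)) hβ' hγ'
      (-(β⁻¹ * t₀)) (-(γ⁻¹ • x₀)) (α ^ 2)⁻¹ Ψ (parabolicCylinder (M * r) z') (r := 3 / 2)
      (by norm_num)
    rw [← hid, ofReal_inv_jacobian_symm, Real.enorm_eq_ofReal (inv_nonneg.2 hα2.le),
      ENNReal.ofReal_rpow_of_nonneg (inv_nonneg.2 hα2.le) (by norm_num),
      ← ENNReal.ofReal_mul (by positivity)] at h1
    have e : (fun w : ℝ × EuclideanSpace ℝ (Fin 3) => ‖p w.1 w.2 - k w.1‖ₑ ^ (3 / 2 : ℝ)) =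
        fun w => ‖(fun t x => p t x - k t) w.1 w.2‖ₑ ^ (3 / 2 : ℝ) := rfl
    rw [e, ← h1]
    exact lintegral_mono_set hsub
  have hpos : 0 ≤ 4 * ((α ^ 2)⁻¹ ^ (3 / 2 : ℝ) * (β * γ ^ 3)) := by positivity
  have hα32 : (α ^ 2)⁻¹ ^ (3 / 2 : ℝ) = α⁻¹ ^ 3 := by
    rw [Real.inv_rpow (by positivity), inv_pow]
    congr 1
    rw [show (α ^ 2 : ℝ) = α ^ (2 : ℝ) by norm_cast, ← Real.rpow_mul hα.le,
      show (2 : ℝ) * (3 / 2) = (3 : ℕ) by norm_num, Real.rpow_natCast]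
  have h4K : (4 : ℝ≥0∞) * ENNReal.ofReal ((α ^ 2)⁻¹ ^ (3 / 2 : ℝ) * (β * γ ^ 3)) =
      ENNReal.ofReal (4 * ((α ^ 2)⁻¹ ^ (3 / 2 : ℝ) * (β * γ ^ 3))) := by
    rw [ENNReal.ofReal_mul (by norm_num : (0 : ℝ) ≤ 4), ENNReal.ofReal_ofNat]
  calc cknDOsc r z p
      = cknDOsc r z (fun t x => p t x - k t) := (cknDOsc_sub_fun_time hr k hp).symm
    _ ≤ 4 * cknD r z (fun t x => p t x - k t) :=
        AlbrittonBarker2019.cknDOsc_le_four_mul_cknD hr hmeas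
    _ = 4 * ((ENNReal.ofReal r ^ 2)⁻¹ *
          ∫⁻ w in parabolicCylinder r z, ‖p w.1 w.2 - k w.1‖ₑ ^ (3 / 2 : ℝ)) := rfl
    _ ≤ 4 * ((ENNReal.ofReal r ^ 2)⁻¹ * (ENNReal.ofReal ((α ^ 2)⁻¹ ^ (3 / 2 : ℝ) * (β * γ ^ 3)) *
          ∫⁻ w in parabolicCylinder (M * r) z', ‖Ψ w.1 w.2‖ₑ ^ (3 / 2 : ℝ))) := by
        gcongr
    _ = (ENNReal.ofReal r ^ 2)⁻¹ * ((4 : ℝ≥0∞) *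
          ENNReal.ofReal ((α ^ 2)⁻¹ ^ (3 / 2 : ℝ) * (β * γ ^ 3))) *
          ∫⁻ w in parabolicCylinder (M * r) z', ‖Ψ w.1 w.2‖ₑ ^ (3 / 2 : ℝ) := by ring
    _ = ENNReal.ofReal (4 * ((α ^ 2)⁻¹ ^ (3 / 2 : ℝ) * (β * γ ^ 3)) * M ^ 2) *
          (ENNReal.ofReal (M * r) ^ 2)⁻¹ *
          ∫⁻ w in parabolicCylinder (M * r) z', ‖Ψ w.1 w.2‖ₑ ^ (3 / 2 : ℝ) := by
        rw [h4K, inv_ofReal_sq_mul_ofReal_eq_enlarge hr hMpos hpos]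
    _ = ENNReal.ofReal (4 * ((α ^ 2)⁻¹ ^ (3 / 2 : ℝ) * (β * γ ^ 3)) * M ^ 2) *
          cknDOsc (M * r) z' π := by
        rw [mul_assoc]; rfl
    _ = _ := by rw [hα32]

/-! ### The sum `A + C + D + E` and the Type I quantity `𝐈` -/

/-- **`A + C + D + E` under the anisotropic rescaling**: the sum of the four comparisons, with
one `r`-independent constant (the sum of the four constants). Hypotheses as for `D`: a.e.-slice
integrability of the `u`-side pressure on the ball (for the gauge) and measurability of the
rescaled gauged pressure on the enlarged `v`-side ball. (The `ν`-normalising,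
anisotropic case is folklore bookkeeping; the printed, parabolic case is the cited reduction.)
[cite: AlbrittonBarker2019, §1 (A, C, D, E, 𝐈 after Thm 1.1); §3, proof of Thm 3.1 (rescaling)] -/
theorem abScaledSum_le_mul_abScaledSum_stRescale (hα : 0 < α) (hβ : 0 < β) (hγ : 0 < γ)
    (t₀ : ℝ) (x₀ : EuclideanSpace ℝ (Fin 3)) {r : ℝ} (hr : 0 < r) (z : ℝ × EuclideanSpace ℝ (Fin 3))
    (u : ℝ → EuclideanSpace ℝ (Fin 3) → EuclideanSpace ℝ (Fin 3))
    {p : ℝ → EuclideanSpace ℝ (Fin 3) → ℝ} (c : ℝ → ℝ)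
    (G : ℝ → EuclideanSpace ℝ (Fin 3) → EuclideanSpace ℝ (Fin 3) →L[ℝ] EuclideanSpace ℝ (Fin 3))
    (hp : ∀ᵐ t ∂(volume.restrict (Ioo (z.1 - r ^ 2) z.1)), IntegrableOn (p t) (ball z.2 r) volume)
    (hπ : AEStronglyMeasurable (uncurry (α ^ 2 • stPull β γ t₀ x₀ (fun t x => p t x - c t)))
      (volume.restrict (parabolicCylinder ((γ⁻¹ + (Real.sqrt β)⁻¹) * r)
        (stAffine β⁻¹ γ⁻¹ (-(β⁻¹ * t₀)) (-(γ⁻¹ • x₀)) z)))) :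
    abScaledSum r z u p G ≤
      (ENNReal.ofReal (α⁻¹ ^ 2 * γ ^ 3 * (γ⁻¹ + (Real.sqrt β)⁻¹)) +
          ENNReal.ofReal (α⁻¹ ^ 3 * (β * γ ^ 3) * (γ⁻¹ + (Real.sqrt β)⁻¹) ^ 2) +
          ENNReal.ofReal (4 * (α⁻¹ ^ 3 * (β * γ ^ 3)) * (γ⁻¹ + (Real.sqrt β)⁻¹) ^ 2) +
          ENNReal.ofReal ((α * γ)⁻¹ ^ 2 * (β * γ ^ 3) * (γ⁻¹ + (Real.sqrt β)⁻¹))) *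
        abScaledSum ((γ⁻¹ + (Real.sqrt β)⁻¹) * r)
          (stAffine β⁻¹ γ⁻¹ (-(β⁻¹ * t₀)) (-(γ⁻¹ • x₀)) z) (α • stPull β γ t₀ x₀ u)
          (α ^ 2 • stPull β γ t₀ x₀ (fun t x => p t x - c t)) ((α * γ) • stPull β γ t₀ x₀ G) := by
  set M : ℝ := γ⁻¹ + (Real.sqrt β)⁻¹ with hM
  set z' := stAffine β⁻¹ γ⁻¹ (-(β⁻¹ * t₀)) (-(γ⁻¹ • x₀)) z with hz'
  set v := α • stPull β γ t₀ x₀ u with hv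
  set π : ℝ → EuclideanSpace ℝ (Fin 3) → ℝ :=
    α ^ 2 • stPull β γ t₀ x₀ (fun t x => p t x - c t) with hπdef
  set Gv := (α * γ) • stPull β γ t₀ x₀ G with hGv
  set KA := ENNReal.ofReal (α⁻¹ ^ 2 * γ ^ 3 * M) with hKA
  set KC := ENNReal.ofReal (α⁻¹ ^ 3 * (β * γ ^ 3) * M ^ 2) with hKC
  set KD := ENNReal.ofReal (4 * (α⁻¹ ^ 3 * (β * γ ^ 3)) * M ^ 2) with hKD
  set KE := ENNReal.ofReal ((α * γ)⁻¹ ^ 2 * (β * γ ^ 3) * M) with hKE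
  set S := abScaledSum (M * r) z' v π Gv with hS
  have hA := cknAEss_le_mul_cknAEss_stRescale hα hβ hγ t₀ x₀ hr z u
  have hC := cknC_le_mul_cknC_stRescale hα hβ hγ t₀ x₀ hr z u
  have hD := cknDOsc_le_mul_cknDOsc_stRescale hα hβ hγ t₀ x₀ hr z c hp hπ
  have hE := cknE_le_mul_cknE_stRescale hα hβ hγ t₀ x₀ hr z G
  calc abScaledSum r z u p G
      = cknAEss r z u + cknC r z u + cknDOsc r z p + cknE r z G := rfl
    _ ≤ KA * cknAEss (M * r) z' v + KC * cknC (M * r) z' v + KD * cknDOsc (M * r) z' π +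
          KE * cknE (M * r) z' Gv := add_le_add (add_le_add (add_le_add hA hC) hD) hE
    _ ≤ KA * S + KC * S + KD * S + KE * S :=
        add_le_add (add_le_add (add_le_add (mul_le_mul' le_rfl cknAEss_le_abScaledSum)
          (mul_le_mul' le_rfl cknC_le_abScaledSum)) (mul_le_mul' le_rfl cknDOsc_le_abScaledSum))
          (mul_le_mul' le_rfl cknE_le_abScaledSum)
    _ = (KA + KC + KD + KE) * S := by ring

/-- **`𝐈` of the apex region under the anisotropic rescaling.** Let `v = α • (u ∘ Φ)`,
`π = α² • ((p − c(t)) ∘ Φ)`, `∇v = (α γ) • ((∇u) ∘ Φ)`, `Φ(s, y) = (t₀ + β s, x₀ + γ y)`. If the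
`u`-side pressure has locally integrable slices below `t₀` (for `t ∈ (t₀ − r₀², t₀)`) and `π` is
a.e.-strongly measurable on `Q(0, ρ)`, and `r₀ (γ⁻¹ + 2(√β)⁻¹) ≤ ρ`, then
`𝐈(Q((t₀, x₀), r₀); u, p, ∇u) ≤ K(α, β, γ) · 𝐈(Q(0, ρ); v, π, ∇v)` with the explicit finite
constant of `abScaledSum_le_mul_abScaledSum_stRescale`: every ball `Q(z, r)` of the apex region
is compared with the enlarged preimage ball `Q(Φ⁻¹ z, M r) ⊆ Q(0, ρ)`
(`parabolicCylinder_symm_subset_of_apex`). (The `ν`-normalising,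
anisotropic case is folklore bookkeeping; the printed, parabolic case is the cited reduction.)
[cite: AlbrittonBarker2019, §1 (A, C, D, E, 𝐈 after Thm 1.1); §3, proof of Thm 3.1 (rescaling)] -/
theorem typeIBound_apex_le_mul_typeIBound_stRescale (hα : 0 < α) (hβ : 0 < β) (hγ : 0 < γ)
    {t₀ : ℝ} {x₀ : EuclideanSpace ℝ (Fin 3)} {r₀ ρ : ℝ} (hρ : r₀ * (γ⁻¹ + 2 * (Real.sqrt β)⁻¹) ≤ ρ)
    (u : ℝ → EuclideanSpace ℝ (Fin 3) → EuclideanSpace ℝ (Fin 3))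
    {p : ℝ → EuclideanSpace ℝ (Fin 3) → ℝ} (c : ℝ → ℝ)
    (G : ℝ → EuclideanSpace ℝ (Fin 3) → EuclideanSpace ℝ (Fin 3) →L[ℝ] EuclideanSpace ℝ (Fin 3))
    (hp : ∀ t ∈ Ioo (t₀ - r₀ ^ 2) t₀, LocallyIntegrable (p t) volume)
    (hπ : AEStronglyMeasurable (uncurry (α ^ 2 • stPull β γ t₀ x₀ (fun t x => p t x - c t)))
      (volume.restrict (parabolicCylinder ρ (0 : ℝ × EuclideanSpace ℝ (Fin 3))))) :
    typeIBound (parabolicCylinder r₀ ((t₀, x₀) : ℝ × EuclideanSpace ℝ (Fin 3))) u p G ≤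
      (ENNReal.ofReal (α⁻¹ ^ 2 * γ ^ 3 * (γ⁻¹ + (Real.sqrt β)⁻¹)) +
          ENNReal.ofReal (α⁻¹ ^ 3 * (β * γ ^ 3) * (γ⁻¹ + (Real.sqrt β)⁻¹) ^ 2) +
          ENNReal.ofReal (4 * (α⁻¹ ^ 3 * (β * γ ^ 3)) * (γ⁻¹ + (Real.sqrt β)⁻¹) ^ 2) +
          ENNReal.ofReal ((α * γ)⁻¹ ^ 2 * (β * γ ^ 3) * (γ⁻¹ + (Real.sqrt β)⁻¹))) *
        typeIBound (parabolicCylinder ρ (0 : ℝ × EuclideanSpace ℝ (Fin 3))) (α • stPull β γ t₀ x₀ u)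
          (α ^ 2 • stPull β γ t₀ x₀ (fun t x => p t x - c t)) ((α * γ) • stPull β γ t₀ x₀ G) := by
  refine typeIBound_le_iff.2 fun r hr z hz => ?_
  have hsub' := parabolicCylinder_symm_subset_of_apex hβ hγ hr hz hρ
  obtain ⟨h1, h2, -⟩ := AlbrittonBarker2019.margins_of_parabolicCylinder_subset hr hz
  simp only at h1 h2
  have hp' : ∀ᵐ t ∂(volume.restrict (Ioo (z.1 - r ^ 2) z.1)),
      IntegrableOn (p t) (ball z.2 r) volume := by
    refine (ae_restrict_iff' measurableSet_Ioo).2 (Eventually.of_forall fun t ht => ?_)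
    have ht' : t ∈ Ioo (t₀ - r₀ ^ 2) t₀ := ⟨by linarith [ht.1], lt_of_lt_of_le ht.2 h1⟩
    exact ((hp t ht').integrableOn_isCompact (isCompact_closedBall z.2 r)).mono_set
      ball_subset_closedBall
  have hπ' := hπ.mono_measure (Measure.restrict_mono hsub' le_rfl)
  exact (abScaledSum_le_mul_abScaledSum_stRescale hα hβ hγ t₀ x₀ hr z u c G hp' hπ').trans
    (mul_le_mul' le_rfl (abScaledSum_le_typeIBound (mul_pos (enlargement_pos hβ hγ) hr) hsub'))

/-- **Un-zooming a local Type I bound.** If the rescaled triple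
`(v, π, ∇v) = (α • (u ∘ Φ), α² • ((p − c(t)) ∘ Φ), (α γ) • ((∇u) ∘ Φ))` has finite Albritton–Barker
quantity `𝐈(Q(0, ρ)) < ∞` on some ball of the `v`-frame (`ρ > 0`), the `u`-side pressure has
locally integrable slices on `(t₀ − δ, t₀)` and `π` is a.e.-strongly measurable on `Q(0, ρ)`,
then `𝐈(Q((t₀, x₀), r₀); u, p, ∇u) < ∞` on some apex ball of the `u`-frame, `0 < r₀`, `r₀² ≤ δ`.
This is the step that carries the tree's zoomed local Type I bound at a Type I blow-up point
(Albritton–Barker 2019, Lemma 2.5 / Remark 3.2 after the viscosity-normalising zoom) back to the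
ORIGINAL frame of a classical solution with viscosity `ν` (`α = R/ν`, `β = R²/ν`, `γ = R`).
(The `ν`-normalising,
anisotropic case is folklore bookkeeping; the printed, parabolic case is the cited reduction.)
[cite: AlbrittonBarker2019, §1 (A, C, D, E, 𝐈 after Thm 1.1); §3, proof of Thm 3.1 (rescaling)] -/
theorem exists_typeIBound_apex_lt_top_of_stRescale (hα : 0 < α) (hβ : 0 < β) (hγ : 0 < γ)
    {t₀ : ℝ} {x₀ : EuclideanSpace ℝ (Fin 3)} {ρ : ℝ} (hρ : 0 < ρ)
    (u : ℝ → EuclideanSpace ℝ (Fin 3) → EuclideanSpace ℝ (Fin 3))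
    {p : ℝ → EuclideanSpace ℝ (Fin 3) → ℝ} (c : ℝ → ℝ)
    (G : ℝ → EuclideanSpace ℝ (Fin 3) → EuclideanSpace ℝ (Fin 3) →L[ℝ] EuclideanSpace ℝ (Fin 3))
    {δ : ℝ} (hδ : 0 < δ)
    (hp : ∀ t ∈ Ioo (t₀ - δ) t₀, LocallyIntegrable (p t) volume)
    (hπ : AEStronglyMeasurable (uncurry (α ^ 2 • stPull β γ t₀ x₀ (fun t x => p t x - c t)))
      (volume.restrict (parabolicCylinder ρ (0 : ℝ × EuclideanSpace ℝ (Fin 3)))))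
    (hfin : typeIBound (parabolicCylinder ρ (0 : ℝ × EuclideanSpace ℝ (Fin 3)))
      (α • stPull β γ t₀ x₀ u) (α ^ 2 • stPull β γ t₀ x₀ (fun t x => p t x - c t))
      ((α * γ) • stPull β γ t₀ x₀ G) < ⊤) :
    ∃ r₀ : ℝ, 0 < r₀ ∧ r₀ ^ 2 ≤ δ ∧
      typeIBound (parabolicCylinder r₀ ((t₀, x₀) : ℝ × EuclideanSpace ℝ (Fin 3))) u p G < ⊤ := by
  set N : ℝ := γ⁻¹ + 2 * (Real.sqrt β)⁻¹ with hN
  have hNpos : 0 < N := by positivity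
  set r₀ : ℝ := min (Real.sqrt δ) (ρ / N) with hr₀def
  have hr₀ : 0 < r₀ := lt_min (Real.sqrt_pos.2 hδ) (div_pos hρ hNpos)
  have hr₀δ : r₀ ^ 2 ≤ δ := by
    have h : r₀ ≤ Real.sqrt δ := min_le_left _ _
    calc r₀ ^ 2 ≤ Real.sqrt δ ^ 2 := pow_le_pow_left₀ hr₀.le h 2
      _ = δ := Real.sq_sqrt hδ.le
  have hρ' : r₀ * N ≤ ρ := by
    have h : r₀ ≤ ρ / N := min_le_right _ _
    rwa [le_div_iff₀ hNpos] at h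
  refine ⟨r₀, hr₀, hr₀δ, ?_⟩
  have hp' : ∀ t ∈ Ioo (t₀ - r₀ ^ 2) t₀, LocallyIntegrable (p t) volume :=
    fun t ht => hp t ⟨by linarith [ht.1], ht.2⟩
  refine lt_of_le_of_lt
    (typeIBound_apex_le_mul_typeIBound_stRescale hα hβ hγ hρ' u c G hp' hπ) ?_
  refine ENNReal.mul_lt_top ?_ hfin
  simp only [ENNReal.add_lt_top, ENNReal.ofReal_lt_top, and_self]

end AnisotropicRescaling

end Literature.Analysis.FluidPDE

end
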